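import Summits.HodgeConjecture.HodgeConjecture.Theorems.F0P3cStCharTSPctOut             -- ★ PCT (LH6-p01): brings ★ CARPET `EllipticData.WeylIntegrationFormula` (Ch12Sec5), the (C1)(C2)(C3) relations (Ch12Sec5Inputs), `IsLocSmooth`, the `U(Φ₃)(L⁺_v)` instances
import Summits.HodgeConjecture.HodgeConjecture.Theorems.F0P3cStCharTSEllCartanCompact   -- ★ «ELL-CARTAN-COMPACT»: `isCompact_centralizer_iff_not_mem_hyperbolicSet` (regular: compact centraliser ⟺ `∉ Ω`)
import Literature.NumberTheory.Automorphic.SmoothCharacterOfCharacter                  -- ★ (F0P3b-p04): `SmoothIrrep.ofChar`, `IrrClass.smoothTrace_mk_ofChar_of_mem` (`Tr ℂ_ξ(φ) = ∫ ξ φ`) — ED. 2 §3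
import HarnessLib

/-!
# F0 · P3c · line LH6 «StCharTS» — EP-G row (G4) «ELL-MASS-G»: THE ELLIPTIC WEYL MASS OF `G_v = U(Φ₃)(L⁺_v)` IS ONE, from an Euler–Poincaré function —
# `Σ_{T ∈ 𝒞_G} |Ω(T, G_v)|⁻¹ ∫_T D_G(t)² dμ_T = 1` [Rogawski1990, §12.5 pp. 182–184, §12.6 Prop. 12.6.1 (a) p. 188 at `π = St_G(ψ)`; Kottwitz1988, §2 Thm. 2]

Cell `pub/hodgecm-mathlib`, crux H413 = `stmt-HodgeConjecture-24833` (lane `--supports … --as helper`), route HCCMUnconditional; seat F0P3b-p01 (g23); RULE-20 brick DEALT BY NAME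
by the G-row dealer F0P3a-p09 (g13) 2026-09-02T23:21:10Z («(G4) ELL-MASS-G — = NOW (statements)»; LEAD T15-09: one of the three EP-SPLIT rider clocks).  THEOREMS ONLY (no
definition ∕ instance ∕ notation ∕ named fact ∕ `sorry`); the §12.5 datum `𝔇` is a BINDER, its relations enter as hypotheses (road rule §2.1).  HONEST LABEL: HC_CM is proved
only modulo the 7 printed citations (2 remaining: hLiu418 = stmt-HodgeConjecture-24832, h413 = stmt-HodgeConjecture-24833) until rung 0 closes; count-neutral helper (it pays
K2′ at `St_G(ψ)` only at t1′, through ★ `F0P3cStCharTSProp1261aOfNorms.innerG_self_eq_of_eq_neg_on_ellG`).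

THE MATHEMATICS — the LITERAL `G`-twin of ★ (B5) `F0P3cStCharTSEllMassH.ellipticWeylMass_H_eq_one_of_epFunction` (road «M5-H», F0P3a-p04 (g29)), in the DATUM's letters
(so no measure is constructed here: the Weyl integration formula, the Cartan book-keeping and the torus measures are the block's pins).  Let `f_G` be an
Euler–Poincaré function on `G_v` — the eight clauses of ★-to-be (G3) `F0P3cStCharTSEPGlueG.exists_epFunction_G` (LH10-p02 (g12), SIG-G3 v1, same ORDER and letters):
locally constant compactly supported, measurable, integrable, `∫ f_G dν = 1`, `f_G(1)` real and negative, canonical orbital integral `1` at the regular classes with COMPACT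
centraliser and `0` at the regular classes with NON-compact centraliser.  Apply the WEYL INTEGRATION FORMULA (★ carpet relation `𝔇.WeylIntegrationFormula`, [§12.5 p. 182])
to `f_G · 1`:  `1 = ∫ f_G = Σ_{T ∈ cartanAll} |Ω(T)|⁻¹ ∫_T D_G(t)² Φ(t, f_G) · 1 dμ_T`.  On an ELLIPTIC representative `T ∈ 𝒞_G = 𝔇.cartanG` (⊆ `cartanAll`, (C1)), `dμ_T`-a.e.
`t ∈ G^e` ((C2) ★ `EllCartanAE`), i.e. `t` regular and `∉ Ω` (pin `hE`), so `Z(t)` is compact (★ «ELL-CARTAN-COMPACT») and `Φ(t, f_G) = 1`; on a NON-elliptic representative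
`dμ_T`-a.e. `t` is regular and `∉ G^e` ((C3) ★ `NonEllCartanAE`), hence hyperbolic with NON-compact centraliser and `Φ(t, f_G) = 0`.  So the Weyl sum collapses to
`Σ_{T ∈ 𝒞_G} |Ω(T)|⁻¹ ∫_T D_G² dμ_T`, which is therefore `1`.  (The integrability side conditions of the formula: on elliptic `T` the integrand is a.e. `D_G²`, integrable by
the hypothesis `hDG2` — the same finiteness every reading of `⟨α, α⟩_e` needs, dischargeable from (L2D∀) at any class with unimodular character; on non-elliptic `T` it is a.e. `0`.)

* §1 `orbInt_eq_one_of_mem_ellG`, `orbInt_eq_zero_of_mem_regG_of_not_mem_ellG` — the two readings of `Φ(t, f_G)` through the pins `horb : 𝔇.orb = mQv`, `hE`, `hreg`.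
* §2 **`ellipticWeylMass_G_eq_one_of_epFunction`** — the head: `∑ T ∈ 𝔇.cartanG, (weylOrder T)⁻¹ * ∫ t : T, (𝔇.DG t)² ∂(𝔇.μT T) = 1`.
* §3 (ED. 2) `char_mk_ofChar_one_eq_one_of_mem_regG` (`χ_{⟦ℂ_1⟧} = 1` on `G^{reg}`, from (M1∀) and ★ `IrrClass.smoothTrace_mk_ofChar_of_mem`), `integrable_DG_sq_of_l2CharOnTorusAll`
  (the binder `hDG2` of §2 from (L2D∀) ★ `L2CharOnTorusAll` read at `⟦ℂ_1⟧` and (C2)), and the head WITHOUT `hDG2`: **`ellipticWeylMass_G_eq_one_of_epFunction_of_l2CharOnTorusAll`**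
  (binders ⊆ those of ★ PCT `pseudoCoeffTrace_Gqs` + the pins + the (G3) clauses — one binder fewer for RIDER 2).

CONSUMERS-IN-WAITING: K2′-St (`⟨χ_{St ψ}, χ_{St ψ}⟩_e = ⟨ψ∘det, ψ∘det⟩_e = Σ_T |Ω_T|⁻¹ ∫_T D_G² = 1`) in RIDER 2 «EP-SPLIT» (LEAD T15-05∕T15-09); (G5) «DET-CHAR + PC-ST».

## References
* [Rogawski1990] J. D. Rogawski, *Automorphic Representations of Unitary Groups in Three Variables*, Ann. of Math. Stud. 123 (1990): §12.5 pp. 182–184 (Weyl integration formula,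
  `⟨ , ⟩_{G,e}`); §12.6 p. 187–188 (pseudo-coefficients, Prop. 12.6.1 (a)); §3.6 pp. 28–31.
* [Kottwitz1988] R. E. Kottwitz, *Tamagawa numbers*, Ann. of Math. 127 (1988), 629–646, §2 Theorem 2 (the Euler–Poincaré function).
-/

set_option autoImplicit false
-- the mandated namespace has the single-problem summit's repeated segment (`HodgeConjecture.HodgeConjecture`)
set_option linter.dupNamespace false

noncomputable section

open NumberField IsDedekindDomain MeasureTheory Filter Topology
open scoped Matrix MatrixGroups ComplexConjugate
open Literature.NumberTheory.Rogawski1990 Literature.NumberTheory.Automorphic Literature.NumberTheory.Automorphic.UnitaryGroup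
open Literature.NumberTheory.Rogawski1990.Ch12Sec5

namespace Summit.HodgeConjecture.HodgeConjecture.Cruxes.H413.F0P3cStCharTSEllMassG

open Summit.HodgeConjecture.HodgeConjecture.Cruxes.H413.F0P3cStCharTSTorusDefs

variable (L : Type) [Field L] [NumberField L] [IsCMField L] (v : HeightOneSpectrum (𝓞 ↥(maximalRealSubfield L)))

/-! ## §1 The two readings of the Euler–Poincaré orbital integrals through the datum pins -/

/-- **`Φ(t, f_G) = 1` at an elliptic `t ∈ G^e`**: `t` is regular and `∉ Ω` (pin `hE`), so its centraliser is compact (★ «ELL-CARTAN-COMPACT») and the (G3) clause `hfE`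
applies through `hC04 : 𝔇.orb = mQv`. [cite: Rogawski1990, §12.5 p. 184; §12.6 p. 187] [cite: Kottwitz1988, §2 Theorem 2] -/
theorem orbInt_eq_one_of_mem_ellG (hns : ∀ w : PlacesOver L v, IsCMField.complexConj L • w.1 = w.1)
    [MeasurableSpace (Gqs L v)] [∀ γ : Gqs L v, MeasurableSpace (Gqs L v ⧸ Subgroup.centralizer ({γ} : Set (Gqs L v)))]
    [MeasurableSpace (Gqs L v ⧸ Subgroup.center (Gqs L v))]
    {H : Type} [Group H] [TopologicalSpace H] [IsTopologicalGroup H] [MeasurableSpace H]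
    (𝔇 : EllipticData (Gqs L v) H) {mQv : OrbitalMeasureFamily (Gqs L v)} (horb : 𝔇.orb = mQv)
    (hE : ∀ γ : Gqs L v, γ ∈ 𝔇.ellG ↔ IsRegularElt (γ.val : GL (Fin 3) (UnitaryGroup.LocalRing L v)) ∧ γ ∉ hyperbolicSet L v)
    {fG : Gqs L v → ℂ}
    (hfE : ∀ γ : Gqs L v, IsRegularElt (γ.val : GL (Fin 3) (UnitaryGroup.LocalRing L v)) →
      IsCompact ((Subgroup.centralizer ({γ} : Set (Gqs L v))) : Set (Gqs L v)) → classOrbitalIntegral mQv fG (ConjClasses.mk γ) = 1)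
    {t : Gqs L v} (ht : t ∈ 𝔇.ellG) : 𝔇.orbInt t fG = 1 := by
  obtain ⟨hreg, hΩ⟩ := (hE t).1 ht
  rw [EllipticData.orbInt, horb]
  exact hfE t hreg (F0P3cStCharTSEllCartanCompact.isCompact_centralizer_of_not_mem_hyperbolicSet L v hns hreg hΩ)

/-- **`Φ(t, f_G) = 0` at a regular `t ∉ G^e`**: such a `t` is hyperbolic (pin `hE`), so its centraliser is NOT compact (★ `isCompact_centralizer_iff_not_mem_hyperbolicSet`)
and the (G3) clause `hfN` applies. [cite: Rogawski1990, §12.5 pp. 182–184] [cite: Kottwitz1988, §2 Theorem 2] -/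
theorem orbInt_eq_zero_of_mem_regG_of_not_mem_ellG (hns : ∀ w : PlacesOver L v, IsCMField.complexConj L • w.1 = w.1)
    [MeasurableSpace (Gqs L v)] [∀ γ : Gqs L v, MeasurableSpace (Gqs L v ⧸ Subgroup.centralizer ({γ} : Set (Gqs L v)))]
    [MeasurableSpace (Gqs L v ⧸ Subgroup.center (Gqs L v))]
    {H : Type} [Group H] [TopologicalSpace H] [IsTopologicalGroup H] [MeasurableSpace H]
    (𝔇 : EllipticData (Gqs L v) H) {mQv : OrbitalMeasureFamily (Gqs L v)} (horb : 𝔇.orb = mQv)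
    (hreg : ∀ γ : Gqs L v, γ ∈ 𝔇.regG ↔ IsRegularElt (γ.val : GL (Fin 3) (UnitaryGroup.LocalRing L v)))
    (hE : ∀ γ : Gqs L v, γ ∈ 𝔇.ellG ↔ IsRegularElt (γ.val : GL (Fin 3) (UnitaryGroup.LocalRing L v)) ∧ γ ∉ hyperbolicSet L v)
    {fG : Gqs L v → ℂ}
    (hfN : ∀ γ : Gqs L v, IsRegularElt (γ.val : GL (Fin 3) (UnitaryGroup.LocalRing L v)) →
      ¬ IsCompact ((Subgroup.centralizer ({γ} : Set (Gqs L v))) : Set (Gqs L v)) → classOrbitalIntegral mQv fG (ConjClasses.mk γ) = 0)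
    {t : Gqs L v} (htreg : t ∈ 𝔇.regG) (htell : t ∉ 𝔇.ellG) : 𝔇.orbInt t fG = 0 := by
  have hreg' : IsRegularElt (t.val : GL (Fin 3) (UnitaryGroup.LocalRing L v)) := (hreg t).1 htreg
  have hΩ : ¬ t ∉ hyperbolicSet L v := fun h => htell ((hE t).2 ⟨hreg', h⟩)
  rw [EllipticData.orbInt, horb]
  refine hfN t hreg' fun hcpt => hΩ ?_
  exact (F0P3cStCharTSEllCartanCompact.isCompact_centralizer_iff_not_mem_hyperbolicSet L v hns hreg').1 hcpt

/-! ## §2 The elliptic Weyl mass of `G_v` from an Euler–Poincaré function -/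

set_option maxHeartbeats 1600000 in
set_option synthInstance.maxHeartbeats 400000 in
/-- **(G4) «ELL-MASS-G»: THE ELLIPTIC WEYL MASS OF `U(Φ₃)(L⁺_v)` IS ONE, FROM AN EULER–POINCARÉ FUNCTION** (`v` non-split).  Frame: the §12.5 datum `𝔇` on `Gqs L v` with
COMPAT `hC01 : 𝔇.μG = νQv`, `hC04 : 𝔇.orb = mQv`, `hC05 : regG ↔ IsRegularElt`, the elliptic-set pin `hE` (VERBATIM), the carpet relations (WIF) ★ `WeylIntegrationFormula`,
(C1) ★ `EllCartanSubset`, (C2) ★ `EllCartanAE`, (C3) ★ `NonEllCartanAE` (the binders of ★ PCT `pseudoCoeffTrace_Gqs`, token for token), and the finiteness `hDG2`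
(`D_G² ∈ L¹(T, μ_T)` on the elliptic representatives — what every value of `⟨ , ⟩_e` presupposes).  Input: `fG` with the EIGHT clauses of ★-to-be (G3) `exists_epFunction_G`
in the same order.  Conclusion: `Σ_{T ∈ 𝔇.cartanG} |Ω(T)|⁻¹ ∫_T D_G(t)² dμ_T = 1` — the `G`-twin of ★ (B5) `ellipticWeylMass_H_eq_one_of_epFunction`.
[cite: Rogawski1990, §12.5 pp. 182–184; §12.6 Prop. 12.6.1 (a) p. 188] [cite: Kottwitz1988, §2 Theorem 2] -/
theorem ellipticWeylMass_G_eq_one_of_epFunction (hns : ∀ w : PlacesOver L v, IsCMField.complexConj L • w.1 = w.1)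
    [MeasurableSpace (Gqs L v)] [BorelSpace (Gqs L v)]
    [∀ γ : Gqs L v, MeasurableSpace (Gqs L v ⧸ Subgroup.centralizer ({γ} : Set (Gqs L v)))]
    [∀ γ : Gqs L v, BorelSpace (Gqs L v ⧸ Subgroup.centralizer ({γ} : Set (Gqs L v)))]
    [MeasurableSpace (Gqs L v ⧸ Subgroup.center (Gqs L v))]
    {H : Type} [Group H] [TopologicalSpace H] [IsTopologicalGroup H] [MeasurableSpace H]
    (νQv : Measure (Gqs L v)) [νQv.IsHaarMeasure] [νQv.IsMulRightInvariant]
    {mQv : OrbitalMeasureFamily (Gqs L v)}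
    (hcanQ : mQv.IsCanonical (fun γ => IsRegularElt (γ.val : GL (Fin 3) (UnitaryGroup.LocalRing L v))) νQv)
    (𝔇 : EllipticData (Gqs L v) H)
    -- ══ COMPAT (hC01, hC04, hC05) ══
    (hμG : 𝔇.μG = νQv) (horb : 𝔇.orb = mQv)
    (hreg : ∀ γ : Gqs L v, γ ∈ 𝔇.regG ↔ IsRegularElt (γ.val : GL (Fin 3) (UnitaryGroup.LocalRing L v)))
    -- ══ the elliptic set (pin `hE` VERBATIM) ══
    (hE : ∀ γ : Gqs L v, γ ∈ 𝔇.ellG ↔ IsRegularElt (γ.val : GL (Fin 3) (UnitaryGroup.LocalRing L v)) ∧ γ ∉ hyperbolicSet L v)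
    -- ══ carpet relations: Weyl integration formula and the Cartan book-keeping (★ PCT's binders) ══
    (hWIF : 𝔇.WeylIntegrationFormula) (hC1 : 𝔇.EllCartanSubset) (hC2 : 𝔇.EllCartanAE) (hC3 : 𝔇.NonEllCartanAE)
    -- ══ finiteness of the elliptic Weyl mass term by term ══
    (hDG2 : ∀ T ∈ 𝔇.cartanG, Integrable (fun t : ↥T => ((𝔇.DG (t : Gqs L v) : ℂ)) ^ 2) (𝔇.μT T))
    -- ══ the Euler–Poincaré function: the eight clauses of (G3) `exists_epFunction_G`, same order ══
    (fG : Gqs L v → ℂ) (hfs : IsLocSmooth fG) (_hfm : Measurable fG) (hfi : Integrable fG νQv) (hf1 : ∫ g, fG g ∂νQv = 1)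
    (_hfim : (fG 1).im = 0) (_hfre : (fG 1).re < 0)
    (hfE : ∀ γ : Gqs L v, IsRegularElt (γ.val : GL (Fin 3) (UnitaryGroup.LocalRing L v)) →
      IsCompact ((Subgroup.centralizer ({γ} : Set (Gqs L v))) : Set (Gqs L v)) → classOrbitalIntegral mQv fG (ConjClasses.mk γ) = 1)
    (hfN : ∀ γ : Gqs L v, IsRegularElt (γ.val : GL (Fin 3) (UnitaryGroup.LocalRing L v)) →
      ¬ IsCompact ((Subgroup.centralizer ({γ} : Set (Gqs L v))) : Set (Gqs L v)) → classOrbitalIntegral mQv fG (ConjClasses.mk γ) = 0) :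
    ∑ T ∈ 𝔇.cartanG, ((weylOrder T : ℂ))⁻¹ * ∫ t : ↥T, ((𝔇.DG (t : Gqs L v) : ℂ)) ^ 2 ∂(𝔇.μT T) = 1 := by
  classical
  have _ := hcanQ
  -- the two a.e. readings of the Weyl integrand `D_G² · Φ(·, f_G) · 1`
  have hell : ∀ T ∈ 𝔇.cartanG,
      (fun t : ↥T => ((𝔇.DG (t : Gqs L v) : ℂ)) ^ 2 * 𝔇.orbInt (t : Gqs L v) fG * (fun _ : Gqs L v => (1 : ℂ)) (t : Gqs L v)) =ᵐ[𝔇.μT T]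
        fun t : ↥T => ((𝔇.DG (t : Gqs L v) : ℂ)) ^ 2 := by
    intro T hT
    filter_upwards [hC2 T hT] with t ht
    rw [orbInt_eq_one_of_mem_ellG L v hns 𝔇 horb hE hfE ht, mul_one, mul_one]
  have hnon : ∀ T ∈ 𝔇.cartanAll, T ∉ 𝔇.cartanG →
      (fun t : ↥T => ((𝔇.DG (t : Gqs L v) : ℂ)) ^ 2 * 𝔇.orbInt (t : Gqs L v) fG * (fun _ : Gqs L v => (1 : ℂ)) (t : Gqs L v)) =ᵐ[𝔇.μT T]
        fun _ : ↥T => (0 : ℂ) := by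
    intro T hT hTn
    filter_upwards [hC3 T hT hTn] with t ht
    rw [orbInt_eq_zero_of_mem_regG_of_not_mem_ellG L v hns 𝔇 horb hreg hE hfN ht.1 ht.2, mul_zero, zero_mul]
  -- the Weyl integration formula at `f_G · 1`
  have hφ : fG ∈ SchwartzBruhat (Gqs L v) := (mem_schwartzBruhat_iff).2 ((isLocSmooth_iff _).1 hfs)
  have hcl : IsClassFunOn 𝔇.regG (fun _ : Gqs L v => (1 : ℂ)) := fun _ _ _ => rfl
  have hint : Integrable (fun g => fG g * (fun _ : Gqs L v => (1 : ℂ)) g) 𝔇.μG := by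
    rw [hμG]; simpa only [mul_one] using hfi
  have hintT : ∀ T ∈ 𝔇.cartanAll,
      Integrable (fun t : ↥T => ((𝔇.DG (t : Gqs L v) : ℂ)) ^ 2 * 𝔇.orbInt (t : Gqs L v) fG * (fun _ : Gqs L v => (1 : ℂ)) (t : Gqs L v)) (𝔇.μT T) := by
    intro T hT
    by_cases hTe : T ∈ 𝔇.cartanG
    · exact (hDG2 T hTe).congr (hell T hTe).symm
    · exact (integrable_zero _ ℂ (𝔇.μT T)).congr (hnon T hT hTe).symm
  have hW := hWIF fG hφ (fun _ => (1 : ℂ)) measurable_const hcl hint hintT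
  -- left side: the mass of `f_G`
  have hL : ∫ g, fG g * (fun _ : Gqs L v => (1 : ℂ)) g ∂𝔇.μG = 1 := by
    rw [hμG]; simpa only [mul_one] using hf1
  -- right side: the non-elliptic representatives contribute `0`, the elliptic ones `∫_T D_G²`
  have hR : ∑ T ∈ 𝔇.cartanAll, ((weylOrder T : ℂ))⁻¹ *
        ∫ t : ↥T, ((𝔇.DG (t : Gqs L v) : ℂ)) ^ 2 * 𝔇.orbInt (t : Gqs L v) fG * (fun _ : Gqs L v => (1 : ℂ)) (t : Gqs L v) ∂(𝔇.μT T) =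
      ∑ T ∈ 𝔇.cartanG, ((weylOrder T : ℂ))⁻¹ * ∫ t : ↥T, ((𝔇.DG (t : Gqs L v) : ℂ)) ^ 2 ∂(𝔇.μT T) := by
    rw [← Finset.sum_subset hC1 (fun T hT hTn => by rw [integral_congr_ae (hnon T hT hTn), integral_zero, mul_zero])]
    refine Finset.sum_congr rfl fun T hT => ?_
    rw [integral_congr_ae (hell T hT)]
  rw [← hR, ← hW, hL]

/-! ## §3 (ED. 2) The finiteness binder `hDG2` of §2 from (L2D∀) and (M1∀), read at the class of the trivial character -/

/-- The kernel of the trivial character `1 : G_v →* ℂˣ` is open (it is all of `G_v`), so `ℂ_1` is a smooth character (★ `SmoothIrrep.ofChar`).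
[cite: Rogawski1990, §12.1 p. 171] -/
theorem isOpen_ker_one_Gqs : IsOpen ((((1 : Gqs L v →* ℂˣ)).ker : Subgroup (Gqs L v)) : Set (Gqs L v)) := by
  rw [MonoidHom.ker_one, Subgroup.coe_top]
  exact isOpen_univ

set_option synthInstance.maxHeartbeats 400000 in
/-- **The Harish-Chandra character of the trivial class is `1` on `G^{reg}`.**  At the class `⟦ℂ_1⟧` of the trivial character (★ `SmoothIrrep.ofChar 1`), (M1∀)
provides `Θ = 𝔇.char ⟦ℂ_1⟧`, locally constant at the points of `regG`, with `Tr ℂ_1(φ) = ∫ φ Θ dν` for `φ ∈ C_c^∞(G_v)`, while ★ `IrrClass.smoothTrace_mk_ofChar_of_mem`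
computes the same trace as `χ_1(φ) = ∫ φ dν`; testing with `φ = 𝟙_U`, `U ∋ x` compact open inside the constancy neighbourhood (★ `exists_isCompact_isOpen_mem_subset`),
gives `ν(U) = ν(U)·Θ(x)` with `0 < ν(U) < ∞`. [cite: Rogawski1990, §1.6 p. 6; §12.5 p. 184] -/
theorem char_mk_ofChar_one_eq_one_of_mem_regG
    [MeasurableSpace (Gqs L v)] [BorelSpace (Gqs L v)] [∀ γ : Gqs L v, MeasurableSpace (Gqs L v ⧸ Subgroup.centralizer ({γ} : Set (Gqs L v)))]
    [MeasurableSpace (Gqs L v ⧸ Subgroup.center (Gqs L v))]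
    {H : Type} [Group H] [TopologicalSpace H] [IsTopologicalGroup H] [MeasurableSpace H]
    (νQv : Measure (Gqs L v)) [νQv.IsHaarMeasure]
    (𝔇 : EllipticData (Gqs L v) H) (hμG : 𝔇.μG = νQv)
    (hM1 : ∀ π : IrrClass (Gqs L v), Measurable (𝔇.char π) ∧ LocallyIntegrable (𝔇.char π) 𝔇.μG ∧
      (∀ x ∈ 𝔇.regG, ∀ᶠ y in 𝓝 x, 𝔇.char π y = 𝔇.char π x) ∧
      ∀ φ : Gqs L v → ℂ, IsLocSmooth φ → π.smoothTrace 𝔇.μG φ = ∫ x, φ x * 𝔇.char π x ∂𝔇.μG)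
    (hξ : IsOpen ((((1 : Gqs L v →* ℂˣ)).ker : Subgroup (Gqs L v)) : Set (Gqs L v)))
    {x : Gqs L v} (hx : x ∈ 𝔇.regG) :
    𝔇.char (IrrClass.mk (SmoothIrrep.ofChar (1 : Gqs L v →* ℂˣ) hξ)) x = 1 := by
  haveI : NonarchimedeanGroup (Gqs L v) :=
    nonarchimedeanGroup_unitaryGroupOfForm_local (E := L) (c := IsCMField.complexConj L) (N := 3) (v := v)
      (J' := (adelicForm L 3 (qsForm L)).map (adeleToLocal L v))
  haveI : TotallyDisconnectedSpace (Gqs L v) := totallyDisconnectedSpace_cmDatum_local L 3 (qsForm L) v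
  obtain ⟨-, -, hlc, htr⟩ := hM1 (IrrClass.mk (SmoothIrrep.ofChar (1 : Gqs L v →* ℂˣ) hξ))
  rw [hμG] at htr
  -- a compact open `U ∋ x` on which `Θ ≡ Θ x`
  obtain ⟨W, hW, hΘW⟩ := (hlc x hx).exists_mem
  obtain ⟨O, hOW, hOo, hxO⟩ := mem_nhds_iff.1 hW
  obtain ⟨U, hUc, hUo, hxU, hUO⟩ := Literature.Topology.exists_isCompact_isOpen_mem_subset hOo hxO
  -- the two evaluations of `Tr ℂ_1(𝟙_U)`
  have hφ : IsLocSmooth (U.indicator fun _ => (1 : ℂ)) := isLocSmooth_indicator hUo hUc.isClosed hUc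
  have hφ' : (U.indicator fun _ => (1 : ℂ)) ∈ SchwartzBruhat (Gqs L v) := (mem_schwartzBruhat_iff).2 ((isLocSmooth_iff _).1 hφ)
  have key := htr _ hφ
  rw [IrrClass.smoothTrace_mk_ofChar_of_mem νQv hξ hφ', charDist_def] at key
  have hL : ∫ g, ((((1 : Gqs L v →* ℂˣ)) g : ℂˣ) : ℂ) * U.indicator (fun _ => (1 : ℂ)) g ∂νQv = (νQv.real U : ℂ) := by
    simp only [MonoidHom.one_apply, Units.val_one, one_mul]
    rw [integral_indicator_const (1 : ℂ) hUo.measurableSet, Complex.real_smul, mul_one]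
  have hR : ∫ g, U.indicator (fun _ => (1 : ℂ)) g * 𝔇.char (IrrClass.mk (SmoothIrrep.ofChar (1 : Gqs L v →* ℂˣ) hξ)) g ∂νQv =
      (νQv.real U : ℂ) * 𝔇.char (IrrClass.mk (SmoothIrrep.ofChar (1 : Gqs L v →* ℂˣ) hξ)) x := by
    have hfun : (fun g => U.indicator (fun _ => (1 : ℂ)) g * 𝔇.char (IrrClass.mk (SmoothIrrep.ofChar (1 : Gqs L v →* ℂˣ) hξ)) g) =
        U.indicator (fun _ => 𝔇.char (IrrClass.mk (SmoothIrrep.ofChar (1 : Gqs L v →* ℂˣ) hξ)) x) := by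
      funext g
      by_cases hg : g ∈ U
      · rw [Set.indicator_of_mem hg, Set.indicator_of_mem hg, one_mul, hΘW g (hOW (hUO hg))]
      · rw [Set.indicator_of_notMem hg, Set.indicator_of_notMem hg, zero_mul]
    rw [hfun, integral_indicator_const _ hUo.measurableSet, Complex.real_smul]
  rw [hL, hR] at key
  have hU0 : (νQv.real U : ℂ) ≠ 0 := by
    rw [Ne, Complex.ofReal_eq_zero, measureReal_def, ENNReal.toReal_eq_zero_iff, not_or]
    exact ⟨(hUo.measure_pos νQv ⟨x, hxU⟩).ne', hUc.measure_lt_top.ne⟩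
  -- `ν(U) · Θ x = ν(U) · 1`
  exact mul_left_cancel₀ hU0 (by rw [mul_one]; exact key.symm)

/-- **The binder `hDG2` of §2 from (L2D∀): on every elliptic representative `T ∈ 𝒞_G`, `D_G² ∈ L¹(T, μ_T)`.**  Read (L2D∀) ★ `L2CharOnTorusAll` — `D_G·χ_π ∈ L²(T, μ_T)`
for EVERY class `π` — at `π = ⟦ℂ_1⟧`: `μ_T`-a.e. `t ∈ G^e` ((C2) ★ `EllCartanAE`), so `t` is regular (pins `hE`, `hreg`) and `χ_{⟦ℂ_1⟧}(t) = 1`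
(★ `char_mk_ofChar_one_eq_one_of_mem_regG`); hence `D_G|_T ∈ L²(T, μ_T)`, i.e. `D_G² = ‖D_G‖² ∈ L¹` (Mathlib `memLp_two_iff_integrable_sq_norm`).
[cite: Rogawski1990, §12.5 p. 184; §12.6 Prop. 12.6.1 pp. 187–188] -/
theorem integrable_DG_sq_of_l2CharOnTorusAll
    [MeasurableSpace (Gqs L v)] [BorelSpace (Gqs L v)] [∀ γ : Gqs L v, MeasurableSpace (Gqs L v ⧸ Subgroup.centralizer ({γ} : Set (Gqs L v)))]
    [MeasurableSpace (Gqs L v ⧸ Subgroup.center (Gqs L v))]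
    {H : Type} [Group H] [TopologicalSpace H] [IsTopologicalGroup H] [MeasurableSpace H]
    (νQv : Measure (Gqs L v)) [νQv.IsHaarMeasure]
    (𝔇 : EllipticData (Gqs L v) H) (hμG : 𝔇.μG = νQv)
    (hreg : ∀ γ : Gqs L v, γ ∈ 𝔇.regG ↔ IsRegularElt (γ.val : GL (Fin 3) (UnitaryGroup.LocalRing L v)))
    (hE : ∀ γ : Gqs L v, γ ∈ 𝔇.ellG ↔ IsRegularElt (γ.val : GL (Fin 3) (UnitaryGroup.LocalRing L v)) ∧ γ ∉ hyperbolicSet L v)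
    (hM1 : ∀ π : IrrClass (Gqs L v), Measurable (𝔇.char π) ∧ LocallyIntegrable (𝔇.char π) 𝔇.μG ∧
      (∀ x ∈ 𝔇.regG, ∀ᶠ y in 𝓝 x, 𝔇.char π y = 𝔇.char π x) ∧
      ∀ φ : Gqs L v → ℂ, IsLocSmooth φ → π.smoothTrace 𝔇.μG φ = ∫ x, φ x * 𝔇.char π x ∂𝔇.μG)
    (hC2 : 𝔇.EllCartanAE) (hL2 : 𝔇.L2CharOnTorusAll) :
    ∀ T ∈ 𝔇.cartanG, Integrable (fun t : ↥T => ((𝔇.DG (t : Gqs L v) : ℂ)) ^ 2) (𝔇.μT T) := by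
  intro T hT
  have hξ : IsOpen ((((1 : Gqs L v →* ℂˣ)).ker : Subgroup (Gqs L v)) : Set (Gqs L v)) := isOpen_ker_one_Gqs L v
  have h1 : ∀ t : Gqs L v, t ∈ 𝔇.ellG → 𝔇.char (IrrClass.mk (SmoothIrrep.ofChar (1 : Gqs L v →* ℂˣ) hξ)) t = 1 := fun t ht =>
    char_mk_ofChar_one_eq_one_of_mem_regG L v νQv 𝔇 hμG hM1 hξ ((hreg t).2 ((hE t).1 ht).1)
  have hae : (fun t : ↥T => (𝔇.DG (t : Gqs L v) : ℂ) * 𝔇.char (IrrClass.mk (SmoothIrrep.ofChar (1 : Gqs L v →* ℂˣ) hξ)) (t : Gqs L v)) =ᵐ[𝔇.μT T]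
      fun t : ↥T => (𝔇.DG (t : Gqs L v) : ℂ) := by
    filter_upwards [hC2 T hT] with t ht
    rw [h1 _ ht, mul_one]
  have h2 : MemLp (fun t : ↥T => (𝔇.DG (t : Gqs L v) : ℂ)) 2 (𝔇.μT T) := (hL2 _ T hT).ae_eq hae
  have h3 : Integrable (fun t : ↥T => ‖(𝔇.DG (t : Gqs L v) : ℂ)‖ ^ 2) (𝔇.μT T) := (memLp_two_iff_integrable_sq_norm h2.1).1 h2
  have hfun : (fun t : ↥T => ((𝔇.DG (t : Gqs L v) : ℂ)) ^ 2) = fun t : ↥T => ((‖(𝔇.DG (t : Gqs L v) : ℂ)‖ ^ 2 : ℝ) : ℂ) := by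
    funext t
    rw [Complex.norm_real, Real.norm_eq_abs, sq_abs, Complex.ofReal_pow]
  rw [hfun]
  exact h3.ofReal

set_option maxHeartbeats 1600000 in
set_option synthInstance.maxHeartbeats 400000 in
/-- **(G4) «ELL-MASS-G» WITHOUT the finiteness binder**: the elliptic Weyl mass of `U(Φ₃)(L⁺_v)` is one, from an Euler–Poincaré function, with `hDG2` of
★ `ellipticWeylMass_G_eq_one_of_epFunction` DISCHARGED by ★ `integrable_DG_sq_of_l2CharOnTorusAll` — binders: COMPAT `hC01 hC04 hC05`, the pin `hE`, (M1∀) `hM1`, the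
carpet relations (WIF) (C1) (C2) (C3) (L2D∀) (all binders of ★ PCT `pseudoCoeffTrace_Gqs`, token for token), and the eight (G3) clauses in order.
`Σ_{T ∈ 𝔇.cartanG} |Ω(T)|⁻¹ ∫_T D_G(t)² dμ_T = 1`. [cite: Rogawski1990, §12.5 pp. 182–184; §12.6 Prop. 12.6.1 (a) p. 188] [cite: Kottwitz1988, §2 Theorem 2] -/
theorem ellipticWeylMass_G_eq_one_of_epFunction_of_l2CharOnTorusAll (hns : ∀ w : PlacesOver L v, IsCMField.complexConj L • w.1 = w.1)
    [MeasurableSpace (Gqs L v)] [BorelSpace (Gqs L v)]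
    [∀ γ : Gqs L v, MeasurableSpace (Gqs L v ⧸ Subgroup.centralizer ({γ} : Set (Gqs L v)))]
    [∀ γ : Gqs L v, BorelSpace (Gqs L v ⧸ Subgroup.centralizer ({γ} : Set (Gqs L v)))]
    [MeasurableSpace (Gqs L v ⧸ Subgroup.center (Gqs L v))]
    {H : Type} [Group H] [TopologicalSpace H] [IsTopologicalGroup H] [MeasurableSpace H]
    (νQv : Measure (Gqs L v)) [νQv.IsHaarMeasure] [νQv.IsMulRightInvariant]
    {mQv : OrbitalMeasureFamily (Gqs L v)}
    (hcanQ : mQv.IsCanonical (fun γ => IsRegularElt (γ.val : GL (Fin 3) (UnitaryGroup.LocalRing L v))) νQv)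
    (𝔇 : EllipticData (Gqs L v) H)
    -- ══ COMPAT (hC01, hC04, hC05) ══
    (hμG : 𝔇.μG = νQv) (horb : 𝔇.orb = mQv)
    (hreg : ∀ γ : Gqs L v, γ ∈ 𝔇.regG ↔ IsRegularElt (γ.val : GL (Fin 3) (UnitaryGroup.LocalRing L v)))
    -- ══ the elliptic set (pin `hE` VERBATIM) ══
    (hE : ∀ γ : Gqs L v, γ ∈ 𝔇.ellG ↔ IsRegularElt (γ.val : GL (Fin 3) (UnitaryGroup.LocalRing L v)) ∧ γ ∉ hyperbolicSet L v)
    -- ══ (M1∀) Harish-Chandra regularity of every `χ_π` (★ PCT's binder, VERBATIM) ══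
    (hM1 : ∀ π : IrrClass (Gqs L v), Measurable (𝔇.char π) ∧ LocallyIntegrable (𝔇.char π) 𝔇.μG ∧
      (∀ x ∈ 𝔇.regG, ∀ᶠ y in 𝓝 x, 𝔇.char π y = 𝔇.char π x) ∧
      ∀ φ : Gqs L v → ℂ, IsLocSmooth φ → π.smoothTrace 𝔇.μG φ = ∫ x, φ x * 𝔇.char π x ∂𝔇.μG)
    -- ══ carpet relations: Weyl integration formula, the Cartan book-keeping and (L2D∀) (★ PCT's binders) ══
    (hWIF : 𝔇.WeylIntegrationFormula) (hC1 : 𝔇.EllCartanSubset) (hC2 : 𝔇.EllCartanAE) (hC3 : 𝔇.NonEllCartanAE) (hL2 : 𝔇.L2CharOnTorusAll)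
    -- ══ the Euler–Poincaré function: the eight clauses of (G3) `exists_epFunction_G`, same order ══
    (fG : Gqs L v → ℂ) (hfs : IsLocSmooth fG) (hfm : Measurable fG) (hfi : Integrable fG νQv) (hf1 : ∫ g, fG g ∂νQv = 1)
    (hfim : (fG 1).im = 0) (hfre : (fG 1).re < 0)
    (hfE : ∀ γ : Gqs L v, IsRegularElt (γ.val : GL (Fin 3) (UnitaryGroup.LocalRing L v)) →
      IsCompact ((Subgroup.centralizer ({γ} : Set (Gqs L v))) : Set (Gqs L v)) → classOrbitalIntegral mQv fG (ConjClasses.mk γ) = 1)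
    (hfN : ∀ γ : Gqs L v, IsRegularElt (γ.val : GL (Fin 3) (UnitaryGroup.LocalRing L v)) →
      ¬ IsCompact ((Subgroup.centralizer ({γ} : Set (Gqs L v))) : Set (Gqs L v)) → classOrbitalIntegral mQv fG (ConjClasses.mk γ) = 0) :
    ∑ T ∈ 𝔇.cartanG, ((weylOrder T : ℂ))⁻¹ * ∫ t : ↥T, ((𝔇.DG (t : Gqs L v) : ℂ)) ^ 2 ∂(𝔇.μT T) = 1 :=
  ellipticWeylMass_G_eq_one_of_epFunction L v hns νQv hcanQ 𝔇 hμG horb hreg hE hWIF hC1 hC2 hC3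
    (integrable_DG_sq_of_l2CharOnTorusAll L v νQv 𝔇 hμG hreg hE hM1 hC2 hL2) fG hfs hfm hfi hf1 hfim hfre hfE hfN

end Summit.HodgeConjecture.HodgeConjecture.Cruxes.H413.F0P3cStCharTSEllMassG

end
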